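import Mathlib
import Summits.ValiantsHypothesis.ValiantsHypothesis.Theorems.DivisionGapPerCofactorDegreeReductionStubHiddenRankOne

/-!
# Crux `DivisionGap.PerCofactorDegreeReduction` (stmt-ValiantsHypothesis-15046), line `Sketch` —
# helper file for stub `stub_hiddenRankOneReal`: reality descent in `ℂ[x]/(q)`

General machinery for the reality step of `stub_hiddenRankOneReal` (sibling file
`…StubHiddenRankOneReal.lean`): the hidden rank-one factors `s, t, u, v` of a balanced creation
identity modulo the permanent, constructed in `S_n = ℂ[x]/(per_n)` by `stub_hiddenRankOne`, can be
represented by REAL homogeneous polynomials.  Nothing here mentions the creation identity.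

* §1 *Graded domains* (grading by submodules, the form of the quotient grading
  `Literature.RingTheory.GradedAlgebra.quotGrading`): factors of a nonzero homogeneous element are
  homogeneous with degrees adding up (`exists_mem_mem_of_mul_mem`, re-bundling the tree's
  `Literature.RingTheory.RegularLocalRing.isHomogeneousElem_of_mul_mem`); units have degree `0`
  (`mem_zero_of_isUnit`).
* §2 *Complex conjugation on `ℂ[x]/(q)`* for `q̄ = q` (`exists_conjQuot`, via `Ideal.quotientMap`):
  an involution (`conjQuot_conjQuot`) fixing the classes of real polynomials (`conjQuot_mk_map`)
  and conjugating constants (`conjQuot_mk_C`); a conjugation-fixed class that is homogeneous for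
  the quotient grading by total degree is the class of a REAL homogeneous polynomial — the real
  part of a homogeneous representative (`exists_real_of_conjQuot_eq`).
* §3 *Constants in `ℂ[x]/(q)`*: degree-`0` classes are constants (`exists_C_of_mem_zero`), units
  are constants (`exists_C_of_isUnit`), homogeneous non-units have positive degree
  (`one_le_of_not_isUnit`), a same-degree divisor of a nonzero homogeneous class differs from it by
  a nonzero constant (`exists_C_mul_of_dvd`, from `HiddenRankOne.exists_mem_zero_of_dvd`), and
  `per_n` divides no nonzero constant (`eq_zero_of_perPoly_dvd_C`); finally the square root of a
  unimodular complex number used for the rescaling (`exists_sq_eq_of_conj_mul_self`).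

Leans on the tree only: `TwoTowerCollapse.coeff_mapRange`, `HiddenRankOne.exists_mem_zero_of_dvd`,
`Literature.RingTheory.RegularLocalRing.isHomogeneousElem_of_mul_mem`,
`Literature.RingTheory.GradedAlgebra.{quotGrading, mem_quotGrading_iff}`, `perPoly_irreducible`;
Mathlib.  No definitions.
-/

noncomputable section

-- `Summit.ValiantsHypothesis.ValiantsHypothesis.…` is the tree's mandated single-conjunct layout
-- (Problem = Summit), so the duplicated namespace component is intended.
set_option linter.dupNamespace false

namespace Summit.ValiantsHypothesis.ValiantsHypothesis.Theorems.DivisionGap.PerCofactorDegreeReduction.HiddenRankOneReal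

open MvPolynomial Literature.Computability.AlgebraicComplexity
open Summit.ValiantsHypothesis.ValiantsHypothesis.Theorems.DivisionGap.PerCofactorDegreeReduction.TwoTowerCollapse
  (coeff_mapRange)
open Summit.ValiantsHypothesis.ValiantsHypothesis.Theorems.DivisionGap.PerCofactorDegreeReduction.HiddenRankOne
  (exists_mem_zero_of_dvd)
open scoped NNReal

/-! ### §1 Graded domains (grading by submodules): factors of homogeneous elements, units -/

section Graded

open DirectSum SetLike Literature.RingTheory.RegularLocalRing

variable {R B : Type*} [CommRing R] [CommRing B] [Algebra R B] [IsDomain B]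
    (ℬ : ℕ → Submodule R B) [GradedAlgebra ℬ]

/-- **Factors of homogeneous elements are homogeneous.** In an `ℕ`-graded domain (grading by
submodules), if `x y ≠ 0` is homogeneous of degree `d` then `x`, `y` are homogeneous of degrees
adding up to `d`.  The grading by submodules is re-bundled as the same grading by additive
subgroups. [folklore] -/
theorem exists_mem_mem_of_mul_mem {x y : B} {d : ℕ} (hxy : x * y ∈ ℬ d) (h0 : x * y ≠ 0) :
    ∃ i j : ℕ, x ∈ ℬ i ∧ y ∈ ℬ j ∧ i + j = d := by
  classical
  -- the same grading, by additive subgroups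
  let 𝒜 : ℕ → AddSubgroup B := fun i => (ℬ i).toAddSubgroup
  letI : GradedRing 𝒜 :=
    { one_mem := (SetLike.GradedOne.one_mem : (1 : B) ∈ ℬ 0)
      mul_mem := fun _ _ _ _ ha hb => SetLike.GradedMul.mul_mem (A := ℬ) ha hb
      decompose' := DirectSum.decompose ℬ
      left_inv := (DirectSum.decompose ℬ).left_inv
      right_inv := (DirectSum.decompose ℬ).right_inv }
  obtain ⟨i, hi⟩ := isHomogeneousElem_of_mul_mem 𝒜 hxy h0
  obtain ⟨j, hj⟩ := isHomogeneousElem_of_mul_mem 𝒜 (x := y) (y := x) (d := d)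
    (by rwa [mul_comm]) (by rwa [mul_comm])
  have hi' : x ∈ ℬ i := hi
  have hj' : y ∈ ℬ j := hj
  exact ⟨i, j, hi', hj',
    (DirectSum.degree_eq_of_mem_mem ℬ hxy (SetLike.mul_mem_graded hi' hj') h0).symm⟩

/-- **Units of an `ℕ`-graded domain are homogeneous of degree `0`** (grading by submodules):
`x y = 1` is homogeneous of degree `0`, so `x`, `y` are homogeneous with degrees adding up to `0`.
[folklore] -/
theorem mem_zero_of_isUnit {x : B} (hx : IsUnit x) : x ∈ ℬ 0 := by
  obtain ⟨y, hxy⟩ := hx.exists_right_inv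
  obtain ⟨i, j, hi, -, hij⟩ := exists_mem_mem_of_mul_mem ℬ (x := x) (y := y) (d := 0)
    (by rw [hxy]; exact SetLike.GradedOne.one_mem) (by rw [hxy]; exact one_ne_zero)
  obtain rfl : i = 0 := by omega
  exact hi

end Graded

/-! ### §2 Complex conjugation on `ℂ[x]/(q)` for a real `q` -/

section Conj

variable {σ : Type*}

/-- **Complex conjugation descends to `ℂ[x]/(q)`** for a polynomial `q` with real coefficients
(`q̄ = q`): the coefficientwise conjugation `τ₀` maps `(q)` into itself. [folklore] -/
theorem exists_conjQuot (q : MvPolynomial σ ℂ) (hq : map (starRingEnd ℂ) q = q) :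
    ∃ τ : MvPolynomial σ ℂ ⧸ Ideal.span {q} →+* MvPolynomial σ ℂ ⧸ Ideal.span {q},
      ∀ p, τ (Ideal.Quotient.mk (Ideal.span {q}) p) =
        Ideal.Quotient.mk (Ideal.span {q}) (map (starRingEnd ℂ) p) := by
  refine ⟨Ideal.quotientMap (Ideal.span {q}) (map (starRingEnd ℂ)) ?_, fun p =>
    Ideal.quotientMap_mk⟩
  rw [Ideal.span_le, Set.singleton_subset_iff, SetLike.mem_coe, Ideal.mem_comap, hq]
  exact Ideal.mem_span_singleton_self q

variable {q : MvPolynomial σ ℂ}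
  {τ : MvPolynomial σ ℂ ⧸ Ideal.span {q} →+* MvPolynomial σ ℂ ⧸ Ideal.span {q}}
  (hτ : ∀ p, τ (Ideal.Quotient.mk (Ideal.span {q}) p) =
    Ideal.Quotient.mk (Ideal.span {q}) (map (starRingEnd ℂ) p))
include hτ

/-- Conjugation on `ℂ[x]/(q)` is an involution. [folklore] -/
theorem conjQuot_conjQuot (x : MvPolynomial σ ℂ ⧸ Ideal.span {q}) : τ (τ x) = x := by
  obtain ⟨p, rfl⟩ := Ideal.Quotient.mk_surjective x
  rw [hτ, hτ, map_map,
    (RingHom.ext Complex.conj_conj : (starRingEnd ℂ).comp (starRingEnd ℂ) = RingHom.id ℂ), map_id]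

/-- Conjugation on `ℂ[x]/(q)` fixes the classes of real polynomials. [folklore] -/
theorem conjQuot_mk_map (r : MvPolynomial σ ℝ) :
    τ (Ideal.Quotient.mk (Ideal.span {q}) (map Complex.ofRealHom r)) =
      Ideal.Quotient.mk (Ideal.span {q}) (map Complex.ofRealHom r) := by
  rw [hτ, map_map,
    (RingHom.ext Complex.conj_ofReal : (starRingEnd ℂ).comp Complex.ofRealHom = Complex.ofRealHom)]

/-- Conjugation on `ℂ[x]/(q)` conjugates constants. [folklore] -/
theorem conjQuot_mk_C (c : ℂ) :
    τ (Ideal.Quotient.mk (Ideal.span {q}) (C c)) =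
      Ideal.Quotient.mk (Ideal.span {q}) (C (starRingEnd ℂ c)) := by
  rw [hτ, map_C]

/-- **Conjugation-fixed homogeneous classes are real.** A class in `ℂ[x]/(q)` that is homogeneous
of degree `e` (for the quotient grading by total degree) and fixed by conjugation is the class of a
REAL homogeneous polynomial of degree `e`: the real part `Re G` of a homogeneous representative
`G`, as `Re G - G = ½ (Ḡ - G) ≡ 0`. [folklore] -/
theorem exists_real_of_conjQuot_eq {e : ℕ} {z : MvPolynomial σ ℂ ⧸ Ideal.span {q}}
    (hz : z ∈ Literature.RingTheory.GradedAlgebra.quotGrading (homogeneousSubmodule σ ℂ)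
      (Ideal.span {q}) e)
    (hfix : τ z = z) :
    ∃ r : MvPolynomial σ ℝ, r.IsHomogeneous e ∧
      Ideal.Quotient.mk (Ideal.span {q}) (map Complex.ofRealHom r) = z := by
  classical
  obtain ⟨G, hG, rfl⟩ := Literature.RingTheory.GradedAlgebra.mem_quotGrading_iff.1 hz
  rw [mem_homogeneousSubmodule] at hG
  refine ⟨AddMonoidAlgebra.map Complex.reAddGroupHom G, fun m hm => hG fun h0 => hm ?_, ?_⟩
  · rw [coeff_mapRange, h0, map_zero]
  · have key : map Complex.ofRealHom
        (AddMonoidAlgebra.map Complex.reAddGroupHom G : MvPolynomial σ ℝ) - G =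
        C (2⁻¹ : ℂ) * (map (starRingEnd ℂ) G - G) := by
      ext m
      simp only [coeff_sub, coeff_map, coeff_mapRange, coeff_C_mul, Complex.ofRealHom_eq_coe,
        Complex.coe_reAddGroupHom]
      apply Complex.ext
      · simp
      · simp
        ring
    rw [← sub_eq_zero, ← map_sub, key, map_mul, map_sub, ← hτ, hfix, sub_self, mul_zero]

end Conj

/-! ### §3 Constants, units and degrees in `ℂ[x]/(q)`; the unimodular square root -/

section Constants

variable {σ : Type*} {q : MvPolynomial σ ℂ}

/-- Degree-`0` classes of `ℂ[x]/(q)` (quotient grading by total degree) are constants. [folklore] -/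
theorem exists_C_of_mem_zero {x : MvPolynomial σ ℂ ⧸ Ideal.span {q}}
    (hx : x ∈ Literature.RingTheory.GradedAlgebra.quotGrading (homogeneousSubmodule σ ℂ)
      (Ideal.span {q}) 0) :
    ∃ c : ℂ, x = Ideal.Quotient.mk (Ideal.span {q}) (C c) := by
  obtain ⟨a, ha, rfl⟩ := Literature.RingTheory.GradedAlgebra.mem_quotGrading_iff.1 hx
  rw [mem_homogeneousSubmodule] at ha
  exact ⟨coeff 0 a, congr_arg _
    (totalDegree_eq_zero_iff_eq_C.mp ((totalDegree_zero_iff_isHomogeneous _).mpr ha))⟩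

/-- **Homogeneous non-units of `ℂ[x]/(q)` have positive degree**: a nonzero class of degree `0` is
a nonzero constant, hence a unit. [folklore] -/
theorem one_le_of_not_isUnit {x : MvPolynomial σ ℂ ⧸ Ideal.span {q}} {e : ℕ}
    (hx : x ∈ Literature.RingTheory.GradedAlgebra.quotGrading (homogeneousSubmodule σ ℂ)
      (Ideal.span {q}) e)
    (hx0 : x ≠ 0) (hxU : ¬ IsUnit x) : 1 ≤ e := by
  by_contra he
  obtain rfl : e = 0 := by omega
  obtain ⟨c, rfl⟩ := exists_C_of_mem_zero hx
  have hc : c ≠ 0 := fun h => hx0 (by rw [h, C_0, map_zero])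
  exact hxU (((isUnit_iff_ne_zero.mpr hc).map C).map _)

/-- A constant proportionality `y = c x` with `c ≠ 0` flips to `x = c⁻¹ y`. [folklore] -/
theorem eq_C_inv_mul {x y : MvPolynomial σ ℂ ⧸ Ideal.span {q}} {c : ℂ} (hc0 : c ≠ 0)
    (hxy : y = Ideal.Quotient.mk (Ideal.span {q}) (C c) * x) :
    x = Ideal.Quotient.mk (Ideal.span {q}) (C c⁻¹) * y := by
  rw [hxy, ← mul_assoc, ← map_mul, ← map_mul, inv_mul_cancel₀ hc0, map_one, map_one, one_mul]

variable [IsDomain (MvPolynomial σ ℂ ⧸ Ideal.span {q})]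
  [GradedAlgebra (Literature.RingTheory.GradedAlgebra.quotGrading (homogeneousSubmodule σ ℂ)
    (Ideal.span {q}))]

/-- **Units of `ℂ[x]/(q)` are constants** when the quotient is a graded domain (quotient grading
by total degree): units have degree `0`. [folklore] -/
theorem exists_C_of_isUnit {w : MvPolynomial σ ℂ ⧸ Ideal.span {q}} (hw : IsUnit w) :
    ∃ c : ℂ, w = Ideal.Quotient.mk (Ideal.span {q}) (C c) :=
  exists_C_of_mem_zero (mem_zero_of_isUnit _ hw)

/-- **Same-degree divisibility in `ℂ[x]/(q)` is by a nonzero constant** (graded domain case): if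
`x ∣ y` with `x`, `y` homogeneous of the same degree and `y ≠ 0` then `y = c x`, `c ∈ ℂˣ`.
[folklore] -/
theorem exists_C_mul_of_dvd {x y : MvPolynomial σ ℂ ⧸ Ideal.span {q}} {d : ℕ}
    (hx : x ∈ Literature.RingTheory.GradedAlgebra.quotGrading (homogeneousSubmodule σ ℂ)
      (Ideal.span {q}) d)
    (hy : y ∈ Literature.RingTheory.GradedAlgebra.quotGrading (homogeneousSubmodule σ ℂ)
      (Ideal.span {q}) d)
    (hy0 : y ≠ 0) (hxy : x ∣ y) :
    ∃ c : ℂ, c ≠ 0 ∧ y = Ideal.Quotient.mk (Ideal.span {q}) (C c) * x := by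
  obtain ⟨w, hw0, hw⟩ := exists_mem_zero_of_dvd _ hx hy hy0 hxy
  obtain ⟨c, rfl⟩ := exists_C_of_mem_zero hw0
  refine ⟨c, ?_, hw⟩
  rintro rfl
  apply hy0
  rw [hw, C_0, map_zero, zero_mul]

end Constants

/-- **The permanent divides no nonzero constant**: `per_n ∣ C c` over `ℂ` forces `c = 0`
(`n ≥ 1`), as `per_n` is irreducible, hence not a unit. [folklore] -/
theorem eq_zero_of_perPoly_dvd_C {n : ℕ} (hn : n ≠ 0) {c : ℂ} (h : perPoly (Fin n) ℂ ∣ C c) :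
    c = 0 := by
  by_contra hc
  haveI : Nonempty (Fin n) := ⟨⟨0, Nat.pos_of_ne_zero hn⟩⟩
  exact (perPoly_irreducible (n := Fin n) (R := ℂ)).not_isUnit
    (isUnit_of_dvd_unit h ((isUnit_iff_ne_zero.2 hc).map C))

/-- **Unimodular square roots**: a complex number `l` with `l̄ l = 1` has a square root `μ` with
`μ̄ μ = 1` (`ℂ` is algebraically closed and `|μ|² = |l| = 1`). [folklore] -/
theorem exists_sq_eq_of_conj_mul_self {l : ℂ} (hl : (starRingEnd ℂ) l * l = 1) :
    ∃ μ : ℂ, μ ^ 2 = l ∧ (starRingEnd ℂ) μ * μ = 1 := by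
  obtain ⟨μ, hμ⟩ := IsAlgClosed.exists_pow_nat_eq l (by norm_num : 0 < 2)
  have hn1 : Complex.normSq l = 1 := by
    rw [← Complex.ofReal_eq_one, Complex.normSq_eq_conj_mul_self]
    exact hl
  rw [← hμ, map_pow] at hn1
  refine ⟨μ, hμ, ?_⟩
  rw [← Complex.normSq_eq_conj_mul_self,
    (pow_eq_one_iff_of_nonneg (Complex.normSq_nonneg μ) two_ne_zero).1 hn1, Complex.ofReal_one]

end Summit.ValiantsHypothesis.ValiantsHypothesis.Theorems.DivisionGap.PerCofactorDegreeReduction.HiddenRankOneReal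

end
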